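import Summits.BirchSwinnertonDyer.Rank1Residual.X2.GreenbergVatsalTorsionLine
import HarnessLib

/-!
# The correction term `t = dim M^H[n]` is an invariant of the Galois module `M[n]`:
# `(M^H)[n] ≃ (M[n])^H`; hence the Greenberg–Vatsal transfer reads
# `#(S^{Σ₀}_{M₁}(L) ⊓ H¹[n]) = #(S^{Σ₀}_{M₂}(L) ⊓ H¹[n])` for `M₁[n] ≅ M₂[n]`

HONEST FRAMING (cell `b2b-bsdres`, run/shared/lean/b2b/bsd-rank1-residual/, verbatim in every
file): the goal of the cell is to DELETE the COMBINATION-SHAPED residual classes of the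
Birch–Swinnerton-Dyer formula for ALL analytic-rank `≤ 1` elliptic curves over `ℚ` — "full BSD
formula for every rank `≤ 1` curve in class `C`" assembled STRICTLY from published theorems — so
that the rank-`≤ 1` remainder becomes exactly the CONSTRUCTION-SHAPED classes, which are TYPED
(missing-input `Prop`s), NOT attempted. This is not "finishing BSD". Sub-cell
`b2b-bsdres-eisenstein-p2` (CLASS-OWNERS row "X2"), gen 9: research route; NO CLAIM BEYOND STATED
CLASSES; nothing here changes a label. Theorems only (no `def`, no named fact, nothing asserted).

WHAT THIS FILE PROVES. The kernel transfer of gens 8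
(`GreenbergVatsalTorsionIso.natCard_gvSelmer_inf_torsion_mul_eq`,
`GreenbergVatsalTorsionLine.natCard_gvSelmer_inf_torsion_mul_eq_of_inertia`) reads
`#(S^{Σ₀}_{M₁}(L) ⊓ H¹[n]) · #M₁^H[n] = #(S^{Σ₀}_{M₂}(L) ⊓ H¹[n]) · #M₂^H[n]` for a
`Γ_K`-isomorphism `θ : M₁[n] ≃ M₂[n]`; the census of route G used that the correction terms
`t_i = dim_{𝔽_p} E_i(ℚ_∞)[p]` CANCEL on a congruence class ("`t` depends on `A[p]` only",
X2-GAP §13.2) — a prose step so far. Here it becomes a kernel lemma: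
* `nonempty_torsionInvariantsEquiv` — `(M^H)[n] ≃ (M[n])^H` (same elements of `M`);
* `natCard_torsionBy_invariants_eq` — `#M₁^H[n] = #M₂^H[n]` for any `H`-equivariant
  `θ : M₁[n] ≃+ M₂[n]`;
* **`natCard_gvSelmer_inf_torsion_eq`**, **`natCard_gvSelmer_inf_torsion_eq_of_inertia`** — the
  transfer WITHOUT the `t`-factors: `#(S^{Σ₀}_{M₁}(L) ⊓ H¹(H,M₁)[n]) = #(S^{Σ₀}_{M₂}(L) ⊓ H¹(H,M₂)[n])`
  under the hypotheses of the gen-8 theorems (finite `M_i^H`). For `M_i = E_i[p^∞]`, `L = ℚ_∞`,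
  `n = p`, `μ_i = 0` this is, with the printed second half of GV Prop. (2.8) (via Prop. (2.5), no
  `H⁰` clause), exactly GV's p. 27 conclusion `λ^{Σ₀}_{E₁} = λ^{Σ₀}_{E₂}` — now WITHOUT the
  hypothesis `H⁰(ℚ, E_i[p]) = 0` and without any correction term.

References: Greenberg–Vatsal, Invent. Math. 142 (2000) = arXiv:math/9906215, §2 Prop. (2.8) and
pp. 26–27.
-/

noncomputable section

open scoped Classical AddSubgroup

open NumberField IsDedekindDomain Field
open Literature.NumberTheory.EllipticCurves Literature.NumberTheory.EllipticCurves.GreenbergSelmer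
  Literature.NumberTheory.GaloisRepresentations
  Summit.BirchSwinnertonDyer.Rank1Residual.X2.TorsionComparison
  Summit.BirchSwinnertonDyer.Rank1Residual.X2.GreenbergVatsalTorsion
  Summit.BirchSwinnertonDyer.Rank1Residual.X2.GreenbergVatsalTorsionIso
  Summit.BirchSwinnertonDyer.Rank1Residual.X2.GreenbergVatsalTorsionLine

universe u

namespace Summit.BirchSwinnertonDyer.Rank1Residual.X2.GreenbergVatsalTorsionInvariants

/-! ## §1. `(M^G)[n] ≃ (M[n])^G`: the `t`-term depends on the `G`-module `M[n]` only -/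

section Generic

variable {G : Type u} [Group G] {M M₁ M₂ : Type u} [AddCommGroup M] [AddCommGroup M₁]
  [AddCommGroup M₂] [DistribMulAction G M] [DistribMulAction G M₁] [DistribMulAction G M₂]

/-- **`(M^G)[n] ≃ (M[n])^G`**: an `n`-torsion invariant and an invariant `n`-torsion point are the
same element of `M` (an explicit bijection, stated as `Nonempty` to keep this file theorems-only).
[folklore] -/
theorem nonempty_torsionInvariantsEquiv (n : ℕ) :
    Nonempty ((invariants G M)[(n : ℤ)] ≃ {y : M[(n : ℤ)] // ∀ g : G, g • y = y}) := ⟨{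
  toFun x := ⟨⟨((x : invariants G M) : M), AddSubgroup.torsionBy.nsmul_iff.mpr (by
      have h : n • (x : invariants G M) = 0 := AddSubgroup.torsionBy.nsmul_iff.mp x.2
      have h' := congrArg (fun z : invariants G M ↦ (z : M)) h
      simp only [AddSubgroupClass.coe_nsmul, ZeroMemClass.coe_zero] at h'
      exact h')⟩,
    fun g ↦ Subtype.ext ((x : invariants G M).2 g)⟩
  invFun y := ⟨⟨((y.1 : M[(n : ℤ)]) : M), fun g ↦ congrArg Subtype.val (y.2 g)⟩,
    AddSubgroup.torsionBy.nsmul_iff.mpr (Subtype.ext (by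
      have h : n • (y.1 : M[(n : ℤ)]) = 0 := AddSubgroup.torsionBy.nsmul y.1
      have h' := congrArg (fun z : M[(n : ℤ)] ↦ (z : M)) h
      simp only [AddSubgroupClass.coe_nsmul, ZeroMemClass.coe_zero] at h' ⊢
      exact h'))⟩
  left_inv _ := rfl
  right_inv _ := rfl }⟩

/-- **`#M₁^G[n] = #M₂^G[n]` whenever `M₁[n] ≅ M₂[n]` as `G`-modules** (`θ` an equivariant additive
isomorphism of the `n`-torsion subgroups): the correction term `t` of the `E(K_∞)[p]`-corrected
comparison is an invariant of the Galois module `M[n]` ("on a congruence class `t` is a class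
invariant", X2-GAP §13.2). [folklore] -/
theorem natCard_torsionBy_invariants_eq (n : ℕ) (θ : M₁[(n : ℤ)] ≃+ M₂[(n : ℤ)])
    (hθ : ∀ (g : G) (m : M₁[(n : ℤ)]), θ (g • m) = g • θ m) :
    Nat.card ((invariants G M₁)[(n : ℤ)]) = Nat.card ((invariants G M₂)[(n : ℤ)]) := by
  refine Nat.card_congr ((nonempty_torsionInvariantsEquiv (G := G) (M := M₁) n).some.trans
    (Equiv.trans ?_ (nonempty_torsionInvariantsEquiv (G := G) (M := M₂) n).some.symm))
  exact
    { toFun := fun y ↦ ⟨θ y.1, fun g ↦ by rw [← hθ, y.2 g]⟩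
      invFun := fun z ↦ ⟨θ.symm z.1, fun g ↦ θ.injective (by rw [hθ, θ.apply_symm_apply, z.2 g])⟩
      left_inv := fun y ↦ Subtype.ext (θ.symm_apply_apply y.1)
      right_inv := fun z ↦ Subtype.ext (θ.apply_symm_apply z.1) }

end Generic

/-! ## §2. The transfer without correction terms -/

section Transfer

variable {K : Type u} [Field K] [NumberField K]
variable (H : Subgroup (absoluteGaloisGroup K)) [H.Normal]
  (M₁ M₂ : Type u) [AddCommGroup M₁] [DistribMulAction (absoluteGaloisGroup K) M₁]
  [TopologicalSpace M₁] [DiscreteTopology M₁]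
  [AddCommGroup M₂] [DistribMulAction (absoluteGaloisGroup K) M₂]
  [TopologicalSpace M₂] [DiscreteTopology M₂]
  (p : ℕ) (L₁ : Data K M₁ p) (L₂ : Data K M₂ p) (S₀ : Set (HeightOneSpectrum (𝓞 K))) (n : ℕ)

omit [NumberField K] [H.Normal] in
/-- `#M^H[n]` is positive for finite `M^H`. [folklore] -/
theorem natCard_torsionBy_invariants_pos (M : Type u) [AddCommGroup M]
    [DistribMulAction (absoluteGaloisGroup K) M] [Finite (invariants H M)] :
    0 < Nat.card ((invariants H M)[(n : ℤ)]) :=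
  Nat.card_pos

/-- **The Greenberg–Vatsal transfer WITHOUT correction terms** (data-compatible form): under the
hypotheses of `GreenbergVatsalTorsionIso.natCard_gvSelmer_inf_torsion_mul_eq` — `n`-divisible
discrete `Γ_K`-modules `M₁, M₂` with continuous orbit maps, unramified at the finite
`v ∉ Σ₀ ∪ {v ∣ p}`, `I_v` trivial on `M_i/M_i⁺_v`, finite `M_i^H`, and a `Γ_K`-isomorphism
`θ : M₁[n] ≃ M₂[n]` carrying `M₁[n] ∩ M₁⁺_v` onto `M₂[n] ∩ M₂⁺_v` —
**`#(S^{Σ₀}_{M₁}(L) ⊓ H¹(H,M₁)[n]) = #(S^{Σ₀}_{M₂}(L) ⊓ H¹(H,M₂)[n])`**: the factors `#M_i^H[n]` of the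
gen-8 statement are EQUAL (`natCard_torsionBy_invariants_eq`) and cancel.
[cite: GreenbergVatsal2000, §2 Prop. (2.8) and pp. 26–27] -/
theorem natCard_gvSelmer_inf_torsion_eq
    (hM₁ : ∀ m : M₁, Continuous fun g : absoluteGaloisGroup K ↦ g • m)
    (hM₂ : ∀ m : M₂, Continuous fun g : absoluteGaloisGroup K ↦ g • m)
    (hdiv₁ : ∀ m : M₁, ∃ m' : M₁, n • m' = m) (hdiv₂ : ∀ m : M₂, ∃ m' : M₂, n • m' = m)
    (hunr₁ : ∀ v : HeightOneSpectrum (𝓞 K), v ∉ S₀ → ((p : ℕ) : 𝓞 K) ∉ v.asIdeal →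
      ∀ x ∈ inertia v, ∀ m : M₁, x • m = m)
    (hunr₂ : ∀ v : HeightOneSpectrum (𝓞 K), v ∉ S₀ → ((p : ℕ) : 𝓞 K) ∉ v.asIdeal →
      ∀ x ∈ inertia v, ∀ m : M₂, x • m = m)
    (htriv₁ : ∀ (v : HeightOneSpectrum (𝓞 K)) (hv : ((p : ℕ) : 𝓞 K) ∈ v.asIdeal),
      ∀ x ∈ inertia v, ∀ m : M₁, x • m - m ∈ (L₁ v hv).plus)
    (htriv₂ : ∀ (v : HeightOneSpectrum (𝓞 K)) (hv : ((p : ℕ) : 𝓞 K) ∈ v.asIdeal),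
      ∀ x ∈ inertia v, ∀ m : M₂, x • m - m ∈ (L₂ v hv).plus)
    [Finite (invariants H M₁)] [Finite (invariants H M₂)]
    (θ : M₁[(n : ℤ)] ≃+ M₂[(n : ℤ)])
    (hθ : ∀ (g : absoluteGaloisGroup K) (m : M₁[(n : ℤ)]), θ (g • m) = g • θ m)
    (hθL : ∀ (v : HeightOneSpectrum (𝓞 K)) (hv : ((p : ℕ) : 𝓞 K) ∈ v.asIdeal),
      (torsionData L₁ n v hv).plus.map (θ : M₁[(n : ℤ)] →+ M₂[(n : ℤ)]) =
        (torsionData L₂ n v hv).plus) :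
    Nat.card (gvSelmer H M₁ p L₁ S₀ ⊓ (subgroupH1 H M₁)[(n : ℤ)] : AddSubgroup (subgroupH1 H M₁)) =
      Nat.card (gvSelmer H M₂ p L₂ S₀ ⊓ (subgroupH1 H M₂)[(n : ℤ)] :
        AddSubgroup (subgroupH1 H M₂)) := by
  have h := natCard_gvSelmer_inf_torsion_mul_eq H M₁ M₂ p L₁ L₂ S₀ n hM₁ hM₂ hdiv₁ hdiv₂ hunr₁
    hunr₂ htriv₁ htriv₂ θ hθ hθL
  rw [natCard_torsionBy_invariants_eq (G := H) n θ (fun g m ↦ hθ g m)] at h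
  exact Nat.eq_of_mul_eq_mul_right (natCard_torsionBy_invariants_pos H n M₂) h

/-- **The Greenberg–Vatsal transfer WITHOUT correction terms, intrinsic form**: as
`natCard_gvSelmer_inf_torsion_eq`, with the data-compatibility of `θ` replaced by the per-module
conditions of `GreenbergVatsalTorsionLine` ("`I_v` moves every point of `M_i[n] ∩ M_i⁺_v`", GV p. 26:
`C[p] ≅ μ_p`, `p` odd) — so for ANY `Γ_K`-isomorphism `θ : M₁[n] ≃ M₂[n]` (route G's `TorsionIso`):
**`#(S^{Σ₀}_{M₁}(L) ⊓ H¹(H,M₁)[n]) = #(S^{Σ₀}_{M₂}(L) ⊓ H¹(H,M₂)[n])`**. For `M_i = E_i[p^∞]` over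
`ℚ_∞` with `μ_i = 0` this is GV's "the order of this group is independent of `i`" and hence
`λ^{Σ₀}_{E₁} = λ^{Σ₀}_{E₂}` (p. 27), with NO `H⁰(ℚ, E_i[p]) = 0` hypothesis and no correction term.
[cite: GreenbergVatsal2000, §2 Prop. (2.8) and pp. 26–27] -/
theorem natCard_gvSelmer_inf_torsion_eq_of_inertia
    (hM₁ : ∀ m : M₁, Continuous fun g : absoluteGaloisGroup K ↦ g • m)
    (hM₂ : ∀ m : M₂, Continuous fun g : absoluteGaloisGroup K ↦ g • m)
    (hdiv₁ : ∀ m : M₁, ∃ m' : M₁, n • m' = m) (hdiv₂ : ∀ m : M₂, ∃ m' : M₂, n • m' = m)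
    (hunr₁ : ∀ v : HeightOneSpectrum (𝓞 K), v ∉ S₀ → ((p : ℕ) : 𝓞 K) ∉ v.asIdeal →
      ∀ x ∈ inertia v, ∀ m : M₁, x • m = m)
    (hunr₂ : ∀ v : HeightOneSpectrum (𝓞 K), v ∉ S₀ → ((p : ℕ) : 𝓞 K) ∉ v.asIdeal →
      ∀ x ∈ inertia v, ∀ m : M₂, x • m = m)
    (htriv₁ : ∀ (v : HeightOneSpectrum (𝓞 K)) (hv : ((p : ℕ) : 𝓞 K) ∈ v.asIdeal),
      ∀ x ∈ inertia v, ∀ m : M₁, x • m - m ∈ (L₁ v hv).plus)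
    (htriv₂ : ∀ (v : HeightOneSpectrum (𝓞 K)) (hv : ((p : ℕ) : 𝓞 K) ∈ v.asIdeal),
      ∀ x ∈ inertia v, ∀ m : M₂, x • m - m ∈ (L₂ v hv).plus)
    (hgen₁ : ∀ (v : HeightOneSpectrum (𝓞 K)) (hv : ((p : ℕ) : 𝓞 K) ∈ v.asIdeal),
      ∀ c ∈ (torsionData L₁ n v hv).plus, ∃ τ ∈ inertia v,
        ∃ c' ∈ (torsionData L₁ n v hv).plus, τ • c' - c' = c)
    (hgen₂ : ∀ (v : HeightOneSpectrum (𝓞 K)) (hv : ((p : ℕ) : 𝓞 K) ∈ v.asIdeal),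
      ∀ c ∈ (torsionData L₂ n v hv).plus, ∃ τ ∈ inertia v,
        ∃ c' ∈ (torsionData L₂ n v hv).plus, τ • c' - c' = c)
    [Finite (invariants H M₁)] [Finite (invariants H M₂)]
    (θ : M₁[(n : ℤ)] ≃+ M₂[(n : ℤ)])
    (hθ : ∀ (g : absoluteGaloisGroup K) (m : M₁[(n : ℤ)]), θ (g • m) = g • θ m) :
    Nat.card (gvSelmer H M₁ p L₁ S₀ ⊓ (subgroupH1 H M₁)[(n : ℤ)] : AddSubgroup (subgroupH1 H M₁)) =
      Nat.card (gvSelmer H M₂ p L₂ S₀ ⊓ (subgroupH1 H M₂)[(n : ℤ)] :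
        AddSubgroup (subgroupH1 H M₂)) := by
  have h := natCard_gvSelmer_inf_torsion_mul_eq_of_inertia H M₁ M₂ p L₁ L₂ S₀ n hM₁ hM₂ hdiv₁
    hdiv₂ hunr₁ hunr₂ htriv₁ htriv₂ hgen₁ hgen₂ θ hθ
  rw [natCard_torsionBy_invariants_eq (G := H) n θ (fun g m ↦ hθ g m)] at h
  exact Nat.eq_of_mul_eq_mul_right (natCard_torsionBy_invariants_pos H n M₂) h

end Transfer

end Summit.BirchSwinnertonDyer.Rank1Residual.X2.GreenbergVatsalTorsionInvariants

end
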